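/-
Copyright: the b2b-balaban cell (near-miss cell 7), T⁴-continuum fan-out; row NE7b ROUND-2 swarm, seat
t4-ne7b-formalise-leaf-04 (gen 3) — row S6g′(a) pt 2-LV, file 3 «THE LAW FOR THE REGION READING» (journal CLAIM
l.9299 ∕ NEXT of l.9496): the cardinality law's two displayed reading fields DISCHARGED for leaf-07 g2's levelled
region reading `regZoneD`, and the law for REALISED pedigrees.  Released under the licence of the surrounding project.
-/
import Summits.QuantumFields.BalabanUV.T4Continuum.Support.HistoryZoneMassLawLevels
import Summits.QuantumFields.BalabanUV.T4Continuum.Support.HistoryZonesOrbitPedigree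

/-!
# Zone mass for the REGION READING: linked zones, birth cardinality, and the law for realised pedigrees

Summits-side support leaf of the T⁴-continuum cell (rung (B)+1 on a FINITE torus only; NOT infinite volume, NOT the
mass gap, NOT the Clay statement; NOT a proof of the spine estimate NE7b).  Row NE7b, route «COUNT», row S6g′
«MASS-BASED SIBLING COUNT» (R-OWNER-22-12 (2)), step (a): the cardinality law AT LEVELS
(`HistoryZoneMassLawLevels.card_zone_le_levels`, this lineage) displays two reading fields — `hlink` (every zone is
`ρ`-LINKED on its level torus) and `hbirth` (a birth's zone has `≤ C₁·(fat + 1)` cells).  Here both are DISCHARGED for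
the zone map the realised pedigrees are actually read by: leaf-07 g2's levelled tolerant REGION READING
`HistoryZones.regZoneD sh n L K lv c reg` (`Support/HistoryZonesDropsRegions`: the `c`-thickening of the union of the
births' regions blocked to the current level) under its hypothesis shape `BirthRegionsD` (range, diameter, merger
CONTACT), given two REGION-LEVEL binders — each birth region is `ρr`-linked and has `≤ Cr·(fat + 1)` cells — which the
index model discharges (`HistoryZoneMass.linked_redZone`; `TreeLength.card_le_treeLen` = the repaired lower half of
B13 (2.30), a PROVED Literature theorem, used BY NAME); and finally for a REALISED corresponding history
(`HistoryZonesOrbitRealise.Corr` + `HistoryRealise.Realises`, leaf-07 g2 ∕ leaf-08) with NO reading binder left.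
[folklore] finite geometry + structural recursion on OUR carriers; nothing is quoted from print, nothing printed is
asserted, no `[cite:]` tag, no `Prop`-valued fact minted; constants symbolic (trigger c2∕c6) — in the realised form
they are the NUMERALS OF OUR OWN MODEL (`c = 32`, `Cb = 4·2^d` from leaf-07 g2's reading; `ρ = 66`, `C₁ = 65^d·4·2^d`),
not constants of print.

WHAT.  §1 `linked_union_of_cdist_le` (two linked sets bridged by a pair at distance `≤ ρ`).  §2 the core zone under
steps: `births_step_le`, **`coreZoneD_succ`** (all births dated `≤ t` ⇒ `coreZoneD (t+1) X = blocks (L^{lv (t+1) − lv t})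
(coreZoneD t X)`), **`linked_coreZoneD_steps`** (a `ρ₀`-linked core with `ρ₀ ≥ 2` stays `ρ₀`-linked: a plateau step
blocks by `1`, a rising step contracts the radius to `ρ₀∕L^j + 1 ≤ ρ₀`), **`linked_coreZoneD`** (structural induction:
births = the region binder; mergers = the partners' cores bridged within `2c` by CONTACT of the thickened zones;
renewals transparent) with radius `max ρr (2c + 2)`, **`linked_regZoneD`** (`linked_thickT`).  §3
`card_regZoneD_born_le` (`#regZoneD (st b) (born b j) ≤ (2c+1)^d·#reg b`).  §4 **`card_regZoneD_le`**: the law at levels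
for the region reading — `#(regZoneD … t X) ≤ zmass sh θ (2A₁C₁) (4A) t X + 2A` with `ρ = max ρr (2c+2)`,
`C₁ = (2c+1)^d·Cr`, NO `hlink`∕`hbirth` binder (`card_zone_le_levels` ∘ `zoneReadingD_of_birthRegionsD`).  §5 the index
model: `card_redZone_le_of_treeLen` (`#redZone m Z ≤ 4·2^d·(f + 1)` for a non-empty face-connected `Z` with
`treeLen Z ≤ f`), and **`card_regZoneD_le_of_corr`**: for `Corr sh pay G P`, `Realises L s R P Z`, `P.lastStep ≤ K`
(leaf-07 g2's hypotheses of `birthRegionsD_of_corr`, `3 ≤ L`, `0 < n`, `s` non-increasing with `DropCtl`), `G`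
chronological, a stride `w ≥ 1` with `(2·cth 32 1 w + 1)^d·5^d·66 ≤ L^{w∕2}∕2` and a decay `θ` with `θ^w ≥ 1∕2`:
`#(regZoneD sh n L K (levelOf s K) 32 (regR sh pay n L K (levelOf s K)) t X) ≤ zmass sh θ (2A₁C₁) (4A) t X + 2A` for
every sub-structure `X` of `G` formed by `t ≤ K` — THE (a) MAJORANT `M t Z` OF THE S6g′ BIND FOR THE INSTANCE, in the
currency of leaf-02 g3's class-linear total; and its pedigree form **`card_regZoneD_genT_le`** for ONE realised
component `P.genT c` of leaf-09's pedigree (∘ leaf-07 g2's `corr_genT_toPGen`, as `birthRegionsD_genT`).  §6 sanity.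

HONEST: geometry∕bookkeeping over OUR carriers and OUR index model; the identification of Bałaban's regions∕histories
with realised pedigrees stays H3 (displayed by the S12 consumer as `RealisedDomains`); `BirthShapeNodup` NOT yet
retired (the bind's END is leaf-05 g2's pt 4 + the instance); NE7b NOT proved; spine 0∕9.  HONEST DEPENDENCY (cell):
continuum YM on T⁴ ⇐ BetaPertH ∧ nine spine estimates (0/9 proved); BetaPertH ⇐ (D1) ∧ (D4) ∧ CAP+tail; G-an2-4
gates asym, D1 and NE2/3/4.  This file changes none of it.
-/

open Finset
open Literature.MathematicalPhysics.QuantumFieldTheory.Balaban1983to89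
open Literature.MathematicalPhysics.QuantumFieldTheory.Balaban1983to89.B13ScaleTransfer
open Literature.MathematicalPhysics.QuantumFieldTheory.Balaban1983to89.TreeLength
open Literature.MathematicalPhysics.QuantumFieldTheory.Balaban1983to89.B16SProfile
open T4PersistenceDictionary T4PartnerMultiplicity
open Summit.QuantumFields.BalabanUV.T4Continuum.PlacementSkeleton
open Summit.QuantumFields.BalabanUV.T4Continuum.Crowding
open Summit.QuantumFields.BalabanUV.T4Continuum.ZoneSkeleton
open Summit.QuantumFields.BalabanUV.T4Continuum.ZoneTorus
open Summit.QuantumFields.BalabanUV.T4Continuum.HistoryZones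
open Summit.QuantumFields.BalabanUV.T4Continuum.HistoryZoneMass
open Summit.QuantumFields.BalabanUV.T4Continuum.HistoryZoneEvolve
open Summit.QuantumFields.BalabanUV.T4Continuum.HistoryZoneMassLaw
open Summit.QuantumFields.BalabanUV.T4Continuum.HistoryZoneEvolveLevels
open Summit.QuantumFields.BalabanUV.T4Continuum.HistoryZoneMassLawLevels
open Summit.QuantumFields.BalabanUV.T4Continuum.HistoryAdmissible
open Summit.QuantumFields.BalabanUV.T4Continuum.HistoryRealise
open Summit.QuantumFields.BalabanUV.T4Continuum.HistoryGen

namespace Summit.QuantumFields.BalabanUV.T4Continuum.HistoryZoneMassRegions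

noncomputable section

variable {d : ℕ}

/-! ## §1 Linked sets bridged by a near pair -/

/-- **TWO LINKED SETS BRIDGED BY A PAIR AT DISTANCE `≤ ρ` HAVE A LINKED UNION.** [folklore] -/
theorem linked_union_of_cdist_le {m ρ : ℕ} {S T : Finset (Fin d → ℕ)} (hS : Linked m ρ S) (hT : Linked m ρ T)
    {x y : Fin d → ℕ} (hx : x ∈ S) (hy : y ∈ T) (hxy : cdist m x y ≤ ρ) : Linked m ρ (S ∪ T) := by
  have liftS : ∀ {u v : Fin d → ℕ}, Relation.ReflTransGen (fun a b => a ∈ S ∧ b ∈ S ∧ cdist m a b ≤ ρ) u v →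
      Relation.ReflTransGen (fun a b => a ∈ S ∪ T ∧ b ∈ S ∪ T ∧ cdist m a b ≤ ρ) u v :=
    fun h => Relation.ReflTransGen.mono (fun _ _ hab => ⟨mem_union_left _ hab.1, mem_union_left _ hab.2.1, hab.2.2⟩) _ _ h
  have liftT : ∀ {u v : Fin d → ℕ}, Relation.ReflTransGen (fun a b => a ∈ T ∧ b ∈ T ∧ cdist m a b ≤ ρ) u v →
      Relation.ReflTransGen (fun a b => a ∈ S ∪ T ∧ b ∈ S ∪ T ∧ cdist m a b ≤ ρ) u v :=
    fun h =>
      Relation.ReflTransGen.mono (fun _ _ hab => ⟨mem_union_right _ hab.1, mem_union_right _ hab.2.1, hab.2.2⟩) _ _ h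
  have bridge : Relation.ReflTransGen (fun a b => a ∈ S ∪ T ∧ b ∈ S ∪ T ∧ cdist m a b ≤ ρ) x y :=
    Relation.ReflTransGen.single ⟨mem_union_left _ hx, mem_union_right _ hy, hxy⟩
  have bridge' : Relation.ReflTransGen (fun a b => a ∈ S ∪ T ∧ b ∈ S ∪ T ∧ cdist m a b ≤ ρ) y x :=
    Relation.ReflTransGen.single ⟨mem_union_right _ hy, mem_union_left _ hx, by rw [cdist_comm]; exact hxy⟩
  intro u hu v hv
  rcases mem_union.1 hu with hu | hu <;> rcases mem_union.1 hv with hv | hv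
  · exact liftS (hS u hu v hv)
  · exact (liftS (hS u hu x hx)).trans (bridge.trans (liftT (hT y hy v hv)))
  · exact (liftT (hT u hu y hy)).trans (bridge'.trans (liftS (hS x hx v hv)))
  · exact liftT (hT u hu v hv)

/-! ## §2 The core zone of the region reading under steps; linkedness -/

section Core

variable {ε : Type*} [DecidableEq ε] {sh : ε → PEv} {n L K c : ℕ} {lv : ℕ → ℕ} {Cb : ℝ} {G : Gen ε}
  {reg : ε → Finset (Fin d → ℕ)}

/-- under chronology every birth of a structure formed by `t` is dated `≤ t` [folklore] -/
theorem births_step_le {X : Gen ε} (hchr : Chrono (PEv.step ∘ sh) X) {t : ℕ} (hft : ftime (PEv.step ∘ sh) X ≤ t) :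
    ∀ b ∈ births X, (sh b).step ≤ t := fun b hb =>
  (st_le_ftime_of_chrono (PEv.step ∘ sh) hchr b (by rw [form]; exact mem_union_left _ hb)).trans hft

/-- **ONE STEP OF THE CORE ZONE IS ONE BLOCKING** (all births dated `≤ t`, level function):
`coreZoneD (t+1) X = blocks (L^{lv (t+1) − lv t}) (coreZoneD t X)`. [folklore] -/
theorem coreZoneD_succ (hlv : LevelFn K lv) {X : Gen ε} {t : ℕ} (hX : ∀ b ∈ births X, (sh b).step ≤ t) :
    coreZoneD sh L lv reg (t + 1) X = blocks (L ^ (lv (t + 1) - lv t)) (coreZoneD sh L lv reg t X) := by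
  rw [coreZoneD, coreZoneD, blocks, biUnion_image]
  refine biUnion_congr rfl fun b hb => ?_
  have hbt := hX b hb
  rw [if_pos (hbt.trans (Nat.le_succ t)), if_pos hbt]
  have hm1 := hlv.monotone hbt
  have hm2 := hlv.mono t
  have he : lv (t + 1) - lv (sh b).step = (lv t - lv (sh b).step) + (lv (t + 1) - lv t) := by omega
  rw [he, pow_add, ← blocks_blocks]
  rfl

/-- **A LINKED CORE STAYS LINKED UNDER STEPS** (radius `ρ₀ ≥ 2`, all births dated `≤ t₁`): a plateau step blocks by `1`
(nothing changes), a rising step by `L^j ≥ 2` gives radius `ρ₀∕L^j + 1 ≤ ρ₀` (`linked_blocks`). [folklore] -/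
theorem linked_coreZoneD_steps (hL : 1 ≤ L) (hlv : LevelFn K lv) {X : Gen ε} {t₁ : ℕ}
    (hX : ∀ b ∈ births X, (sh b).step ≤ t₁) {ρ₀ : ℕ} (hρ₀ : 2 ≤ ρ₀)
    (h : Linked (sideD n L K lv t₁) ρ₀ (coreZoneD sh L lv reg t₁ X)) :
    ∀ k : ℕ, t₁ + k ≤ K → Linked (sideD n L K lv (t₁ + k)) ρ₀ (coreZoneD sh L lv reg (t₁ + k) X)
  | 0, _ => h
  | k + 1, hk => by
      have ih := linked_coreZoneD_steps hL hlv hX hρ₀ h k (Nat.le_of_succ_le hk)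
      set r : ℕ := L ^ (lv (t₁ + k + 1) - lv (t₁ + k)) with hr
      have hr1 : 1 ≤ r := Nat.one_le_pow _ _ hL
      have hsd : sideD n L K lv (t₁ + k) = sideD n L K lv (t₁ + k + 1) * r := sideD_add hlv (k := 1) hk
      have hcore : coreZoneD sh L lv reg (t₁ + k + 1) X = blocks r (coreZoneD sh L lv reg (t₁ + k) X) :=
        coreZoneD_succ hlv fun b hb => (hX b hb).trans (Nat.le_add_right t₁ k)
      rw [hsd] at ih
      show Linked (sideD n L K lv (t₁ + k + 1)) ρ₀ (coreZoneD sh L lv reg (t₁ + k + 1) X)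
      rw [hcore]
      by_cases hr1' : r = 1
      · rw [hr1', blocks_one]
        rw [hr1', mul_one] at ih
        exact ih
      · have hr2 : 2 ≤ r := by omega
        refine (linked_blocks hr1 ih).mono ?_
        have := Nat.div_le_div_left hr2 (by norm_num : 0 < 2) (a := ρ₀)
        omega

/-- **THE CORE ZONE OF THE REGION READING IS LINKED** (radius `max ρr (2c + 2)`): births are `ρr`-linked regions; at a
merger the partners' cores are bridged within `2c` by the CONTACT of their `c`-thickened zones; steps preserve;
renewals are transparent. [folklore] -/
theorem linked_coreZoneD (hL : 1 ≤ L) (hlv : LevelFn K lv) (hB : BirthRegionsD sh n L K lv Cb c G reg)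
    (hchr : Chrono (PEv.step ∘ sh) G) {ρr : ℕ}
    (hregL : ∀ b ∈ births G, Linked (sideD n L K lv (sh b).step) ρr (reg b)) :
    ∀ {X : Gen ε}, Sub X G → ∀ {t : ℕ}, ftime (PEv.step ∘ sh) X ≤ t → t ≤ K →
      Linked (sideD n L K lv t) (max ρr (2 * c + 2)) (coreZoneD sh L lv reg t X)
  | Gen.born b j, hX, t, hft, htK => by
      have hb : b ∈ births G := births_subset_of_subE hX (by simp)
      have hft' : (sh b).step ≤ t := hft
      have h0 : Linked (sideD n L K lv (sh b).step) (max ρr (2 * c + 2))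
          (coreZoneD sh L lv reg (sh b).step (Gen.born b j)) := by
        rw [coreZoneD_born_self]
        exact (hregL b hb).mono (le_max_left _ _)
      have hbs : ∀ b' ∈ births (Gen.born b j), (sh b').step ≤ (sh b).step := by
        intro b' hb'
        rw [births_born, mem_singleton] at hb'
        rw [hb']
      have h := linked_coreZoneD_steps hL hlv hbs (le_max_of_le_right (by omega)) h0 (t - (sh b).step) (by omega)
      rwa [Nat.add_sub_cancel' hft'] at h
  | Gen.renew Y e h, hX, t, hft, htK => by
      have hY : Sub Y G := Sub.trans (Sub.renew e h (Sub.refl Y)) hX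
      exact linked_coreZoneD hL hlv hB hchr hregL hY hft htK
  | Gen.merge Y Z e, hX, t, hft, htK => by
      have hfte : (sh e).step ≤ t := hft
      have hchrX := chrono_of_sub (PEv.step ∘ sh) hX hchr
      obtain ⟨hfY, hfZ⟩ := ftime_le_of_chrono (PEv.step ∘ sh) hchrX
      have hY : Sub Y G := Sub.trans (Sub.left Z e (Sub.refl Y)) hX
      have hZ : Sub Z G := Sub.trans (Sub.right Y e (Sub.refl Z)) hX
      have hsK : (sh e).step ≤ K := hfte.trans htK
      have hlY := linked_coreZoneD hL hlv hB hchr hregL hY hfY hsK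
      have hlZ := linked_coreZoneD hL hlv hB hchr hregL hZ hfZ hsK
      -- contact at the merger's step: a shared cell of the thickened zones puts two core cells within `2c`
      obtain ⟨z, hzY, hzZ⟩ := hB.contact Y Z e hX
      obtain ⟨hzr, y, hy, hdy⟩ := mem_thickT.1 hzY
      obtain ⟨-, w, hw, hdw⟩ := mem_thickT.1 hzZ
      have hRY := inRange_coreZoneD hL hlv hB hY (sh e).step
      have hRZ := inRange_coreZoneD hL hlv hB hZ (sh e).step
      rw [cdist_comm] at hdy
      have htri := cdist_triangle (hRY y hy) hzr (hRZ w hw)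
      have h1 : cdist (n * L ^ (K - lv (sh e).step)) y w ≤ 2 * c + 2 := by omega
      have hyw : cdist (sideD n L K lv (sh e).step) y w ≤ max ρr (2 * c + 2) := h1.trans (le_max_right _ _)
      have h0 : Linked (sideD n L K lv (sh e).step) (max ρr (2 * c + 2))
          (coreZoneD sh L lv reg (sh e).step (Gen.merge Y Z e)) := by
        rw [coreZoneD_merge]
        exact linked_union_of_cdist_le hlY hlZ hy hw hyw
      have hbs : ∀ b' ∈ births (Gen.merge Y Z e), (sh b').step ≤ (sh e).step :=
        births_step_le hchrX (t := (sh e).step) le_rfl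
      have h := linked_coreZoneD_steps hL hlv hbs (le_max_of_le_right (by omega)) h0 (t - (sh e).step) (by omega)
      rwa [Nat.add_sub_cancel' hfte] at h

/-- **THE REGION READING'S ZONES ARE LINKED** on their level tori, radius `max ρr (2c + 2)` (the `c`-thickening of a
linked core in range, `linked_thickT`). [folklore] -/
theorem linked_regZoneD (hL : 1 ≤ L) (hlv : LevelFn K lv) (hB : BirthRegionsD sh n L K lv Cb c G reg)
    (hchr : Chrono (PEv.step ∘ sh) G) {ρr : ℕ}
    (hregL : ∀ b ∈ births G, Linked (sideD n L K lv (sh b).step) ρr (reg b)) {X : Gen ε} (hX : Sub X G) {t : ℕ}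
    (hft : ftime (PEv.step ∘ sh) X ≤ t) (htK : t ≤ K) :
    Linked (sideD n L K lv t) (max ρr (2 * c + 2)) (regZoneD sh n L K lv c reg t X) := by
  have h := linked_thickT c (inRange_coreZoneD hL hlv hB hX t) (linked_coreZoneD hL hlv hB hchr hregL hX hft htK)
  rw [max_eq_left (le_max_of_le_right (by omega) : c ≤ max ρr (2 * c + 2))] at h
  exact h

/-! ## §3 The birth cardinality of the region reading -/

/-- a bare birth's zone at its own step has at most `(2c+1)^d·#reg b` cells [folklore] -/
theorem card_regZoneD_born_le (hB : BirthRegionsD sh n L K lv Cb c G reg) {b : ε} {j : ℕ}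
    (hX : Sub (Gen.born b j) G) :
    (regZoneD sh n L K lv c reg (sh b).step (Gen.born b j)).card ≤ (2 * c + 1) ^ d * (reg b).card := by
  rw [regZoneD_born_self]
  exact card_thickT_le c (hB.inRange b (births_subset_of_subE hX (by simp)))

/-! ## §4 The law at levels for the region reading -/

/-- **THE CARDINALITY LAW FOR THE REGION READING** (no `hlink`∕`hbirth` binder): `L ≥ 1`, a level function, the
birth-region laws at levels (`BirthRegionsD`: range, diameter, merger contact), chronology, every birth region
`ρr`-linked with `≤ Cr·(fat + 1)` cells, a stride `s` with level advance `m` and smallness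
`(2·cth c 1 s + 1)^d·5^d·max ρr (2c+2) ≤ L^m∕2`, a decay `θ` with `θ^s ≥ 1∕2` ⇒ every sub-structure `X` of `G` formed by
`t ≤ K` has `#(regZoneD … t X) ≤ zmass sh θ (2A₁C₁) (4A) t X + 2A`, `A₁ = (2·cth c 1 s + 1)^d`, `A = A₁·5^d`,
`C₁ = (2c+1)^d·Cr`. [folklore] -/
theorem card_regZoneD_le (hL : 1 ≤ L) (hlv : LevelFn K lv) (hB : BirthRegionsD sh n L K lv Cb c G reg)
    (hchr : Chrono (PEv.step ∘ sh) G) {ρr : ℕ}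
    (hregL : ∀ b ∈ births G, Linked (sideD n L K lv (sh b).step) ρr (reg b))
    {Cr : ℝ} (hCr : 0 ≤ Cr) (hregN : ∀ b ∈ births G, ((reg b).card : ℝ) ≤ Cr * (((sh b).fat : ℝ) + 1))
    {s m : ℕ} (hs : 1 ≤ s) (hm : ∀ u : ℕ, u + s ≤ K → lv u + m ≤ lv (u + s))
    (hsmall : (((2 * cth c 1 s + 1) ^ d : ℕ) : ℝ) * (5 : ℝ) ^ d * ((max ρr (2 * c + 2) : ℕ) : ℝ) ≤ (L : ℝ) ^ m / 2)
    {θ : ℝ} (hθ0 : 0 ≤ θ) (hθ1 : θ ≤ 1) (hθs : 1 / 2 ≤ θ ^ s) :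
    ∀ (t : ℕ) (X : Gen ε), Sub X G → ftime (PEv.step ∘ sh) X ≤ t → t ≤ K →
      ((regZoneD sh n L K lv c reg t X).card : ℝ) ≤
        zmass sh θ (2 * (((2 * cth c 1 s + 1) ^ d : ℕ) : ℝ) * ((((2 * c + 1) ^ d : ℕ) : ℝ) * Cr))
            (4 * ((((2 * cth c 1 s + 1) ^ d : ℕ) : ℝ) * (5 : ℝ) ^ d)) t X +
          2 * ((((2 * cth c 1 s + 1) ^ d : ℕ) : ℝ) * (5 : ℝ) ^ d) :=
  card_zone_le_levels hL hlv (zoneReadingD_of_birthRegionsD hL hlv hchr hB) hchr (ρ := max ρr (2 * c + 2))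
    (le_max_of_le_right (by omega)) (fun _ _ hX hft htK => linked_regZoneD hL hlv hB hchr hregL hX hft htK)
    (C₁ := (((2 * c + 1) ^ d : ℕ) : ℝ) * Cr) (by positivity)
    (fun b j hX => by
      have h1 := card_regZoneD_born_le hB hX
      have h2 := hregN b (births_subset_of_subE hX (by simp))
      calc ((regZoneD sh n L K lv c reg (sh b).step (Gen.born b j)).card : ℝ)
          ≤ (((2 * c + 1) ^ d : ℕ) : ℝ) * ((reg b).card : ℝ) := by exact_mod_cast h1
        _ ≤ (((2 * c + 1) ^ d : ℕ) : ℝ) * (Cr * (((sh b).fat : ℝ) + 1)) :=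
            mul_le_mul_of_nonneg_left h2 (Nat.cast_nonneg _)
        _ = (((2 * c + 1) ^ d : ℕ) : ℝ) * Cr * (((sh b).fat : ℝ) + 1) := by ring)
    hs hm hsmall hθ0 hθ1 hθs

end Core

/-! ## §5 The index model: reduced face-connected regions; the law for realised pedigrees -/

section Realised

/-- **A REDUCED FACE-CONNECTED CUBE FAMILY OF TREE LENGTH `≤ f` HAS AT MOST `4·2^d·(f + 1)` CELLS** (the reduction does
not increase the count; `TreeLength.card_le_treeLen`: `#Z ≤ 2^d·(4·treeLen Z + 1)`). [folklore] -/
theorem card_redZone_le_of_treeLen (m : ℕ) {Z : Finset (Pt d)} (hne : Z.Nonempty) (hfc : FaceConnected Z) {f : ℝ}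
    (hfat : treeLen Z ≤ f) : ((redZone m Z).card : ℝ) ≤ 4 * 2 ^ d * (f + 1) := by
  have h1 : ((redZone m Z).card : ℝ) ≤ (Z.card : ℝ) := by
    unfold redZone
    exact_mod_cast card_image_le
  have h2 := card_le_treeLen hne hfc
  have h3 : (0 : ℝ) ≤ 2 ^ d := by positivity
  have h4 : (2 : ℝ) ^ d * (4 * treeLen Z + 1) ≤ 2 ^ d * (4 * f + 1) := mul_le_mul_of_nonneg_left (by linarith) h3
  nlinarith

variable {ε : Type*} [DecidableEq ε] {sh : ε → PEv} {pay : ε → Pt d × Finset (Pt d)} {n L K : ℕ} {s R : ℕ → ℕ}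
  {P : PGen (Pt d × Finset (Pt d))} {G : Gen ε} {Z : Finset (Pt d)}

/-- **THE CARDINALITY LAW FOR REALISED PEDIGREES** (row S6g′(a) for the instance; every reading binder discharged).  For
a tagged genealogy `G` in node-wise correspondence (`Corr sh pay`) with a census history `P` realised on the torus
(`Realises L s R P Z`, `P.lastStep ≤ K`) — leaf-07 g2's hypotheses of `birthRegionsD_of_corr` (`3 ≤ L`, `0 < n`, `s`
non-increasing with `DropCtl`) — `G` chronological, a stride `w ≥ 1` with `(2·cth 32 1 w + 1)^d·5^d·66 ≤ L^{w∕2}∕2` and a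
decay `0 ≤ θ ≤ 1` with `θ^w ≥ 1∕2`: every sub-structure `X` of `G` formed by `t ≤ K` has
`#(regZoneD sh n L K (levelOf s K) 32 (regR sh pay n L K (levelOf s K)) t X) ≤ zmass sh θ (2A₁C₁) (4A) t X + 2A` with
`A₁ = (2·cth 32 1 w + 1)^d`, `A = A₁·5^d`, `C₁ = 65^d·(4·2^d)`. [folklore] -/
theorem card_regZoneD_le_of_corr (hL : 3 ≤ L) (hn : 0 < n) (hs : ∀ t, s (t + 1) ≤ s t) (hdrop : ∀ m, DropCtl s m)
    (hc : Corr sh pay G P) (hR : Realises L s R P Z) (hK : P.lastStep ≤ K) (hchr : Chrono (PEv.step ∘ sh) G)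
    {w : ℕ} (hw : 1 ≤ w)
    (hsmall : (((2 * cth 32 1 w + 1) ^ d : ℕ) : ℝ) * (5 : ℝ) ^ d * ((66 : ℕ) : ℝ) ≤ (L : ℝ) ^ (w / 2) / 2)
    {θ : ℝ} (hθ0 : 0 ≤ θ) (hθ1 : θ ≤ 1) (hθw : 1 / 2 ≤ θ ^ w) :
    ∀ (t : ℕ) (X : Gen ε), Sub X G → ftime (PEv.step ∘ sh) X ≤ t → t ≤ K →
      ((regZoneD sh n L K (levelOf s K) 32 (regR sh pay n L K (levelOf s K)) t X).card : ℝ) ≤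
        zmass sh θ (2 * (((2 * cth 32 1 w + 1) ^ d : ℕ) : ℝ) * ((((2 * 32 + 1) ^ d : ℕ) : ℝ) * (4 * 2 ^ d)))
            (4 * ((((2 * cth 32 1 w + 1) ^ d : ℕ) : ℝ) * (5 : ℝ) ^ d)) t X +
          2 * ((((2 * cth 32 1 w + 1) ^ d : ℕ) : ℝ) * (5 : ℝ) ^ d) := by
  have hL1 : 1 ≤ L := by omega
  have hlv : LevelFn K (levelOf s K) := levelFn_levelOf (fun t _ => hs t) (hdrop K)
  have hB := birthRegionsD_of_corr hL hn hs hdrop hc hR hK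
  have hregL : ∀ b ∈ births G,
      Linked (sideD n L K (levelOf s K) (sh b).step) 1 (regR sh pay n L K (levelOf s K) b) := fun b hb =>
    linked_redZone (Nat.mul_pos hn (pow_pos (by omega) _)) (births_facts_of_corr P G Z hc hR b hb).2.2.1
  have hregN : ∀ b ∈ births G,
      ((regR sh pay n L K (levelOf s K) b).card : ℝ) ≤ 4 * 2 ^ d * (((sh b).fat : ℝ) + 1) := fun b hb => by
    obtain ⟨-, hz, hfc, hlen⟩ := births_facts_of_corr P G Z hc hR b hb
    exact card_redZone_le_of_treeLen _ ⟨_, hz⟩ hfc hlen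
  have hsmall' : (((2 * cth 32 1 w + 1) ^ d : ℕ) : ℝ) * (5 : ℝ) ^ d * ((max 1 (2 * 32 + 2) : ℕ) : ℝ) ≤
      (L : ℝ) ^ (w / 2) / 2 := by
    rw [show (max 1 (2 * 32 + 2) : ℕ) = 66 from rfl]; exact hsmall
  exact card_regZoneD_le hL1 hlv hB hchr hregL (by positivity) hregN hw
    (fun u _ => levelFn_add_half_le hlv u w) hsmall' hθ0 hθ1 hθw

/-- **THE CARDINALITY LAW FOR ONE REALISED COMPONENT OF A PEDIGREE** (the form the S12 instance reads: leaf-09's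
tagged genealogy `P.genT c`, shapes `Prod.fst`, regions `regR Prod.fst (payOfTag cellP)`, `lv := levelOf s K`, collar
`32`; hypotheses = leaf-07 g2's `birthRegionsD_genT` + chronology of `P.genT c` (leaf-09's `chronoC_genT`) + the stride
∕ smallness ∕ decay of `card_regZoneD_le_of_corr`). [folklore] -/
theorem card_regZoneD_genT_le {α π : Type*} [DecidableEq α] [DecidableEq π] (cellP : π → Pt d × Finset (Pt d))
    (hL : 3 ≤ L) (hn : 0 < n) (hs : ∀ t, s (t + 1) ≤ s t) (hdrop : ∀ m, DropCtl s m) (P : Pedigree α π)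
    (hS : ∀ c c', Part.old c' true ∈ P.parts c → P.step c' + 1 = P.step c) (c : α) {Z : Finset (Pt d)}
    (hR : Realises L s R (P.toPGen cellP c) Z) (hK : (P.toPGen cellP c).lastStep ≤ K)
    (hchr : Chrono (PEv.step ∘ Prod.fst) (P.genT c)) {w : ℕ} (hw : 1 ≤ w)
    (hsmall : (((2 * cth 32 1 w + 1) ^ d : ℕ) : ℝ) * (5 : ℝ) ^ d * ((66 : ℕ) : ℝ) ≤ (L : ℝ) ^ (w / 2) / 2)
    {θ : ℝ} (hθ0 : 0 ≤ θ) (hθ1 : θ ≤ 1) (hθw : 1 / 2 ≤ θ ^ w) :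
    ∀ (t : ℕ) (X : Gen (Lab α π)), Sub X (P.genT c) → ftime (PEv.step ∘ Prod.fst) X ≤ t → t ≤ K →
      ((regZoneD Prod.fst n L K (levelOf s K) 32 (regR Prod.fst (payOfTag cellP) n L K (levelOf s K)) t X).card : ℝ) ≤
        zmass Prod.fst θ (2 * (((2 * cth 32 1 w + 1) ^ d : ℕ) : ℝ) * ((((2 * 32 + 1) ^ d : ℕ) : ℝ) * (4 * 2 ^ d)))
            (4 * ((((2 * cth 32 1 w + 1) ^ d : ℕ) : ℝ) * (5 : ℝ) ^ d)) t X +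
          2 * ((((2 * cth 32 1 w + 1) ^ d : ℕ) : ℝ) * (5 : ℝ) ^ d) :=
  card_regZoneD_le_of_corr hL hn hs hdrop (corr_genT_toPGen cellP P hS c) hR hK hchr hw hsmall hθ0 hθ1 hθw

end Realised

/-! ## §6 Sanity (decided ∕ closed instances) -/

namespace Sanity

/-- one step of the core zone of a single birth on a drop-free life is one blocking by `L` (decided on `(ℤ∕8)¹`,
`L = 2`, region `{4, 5, 6}` at step `0`, seen at step `1`: blocks `{2, 3}`) -/
example : coreZoneD (Prod.fst : PEv × ℕ → PEv) 2 (fun t => t) (fun _ => ({![4], ![5], ![6]} : Finset (Fin 1 → ℕ))) 1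
      (Gen.born (((0, 0, 0) : PEv), 0) 0) = {![2], ![3]} := by
  decide

/-- the realised form's smallness for `d = 1`, stride `w = 4` (`cth 32 1 4 = 132`, `A₁ = 265`), `L = 10^6`
(`m = w∕2 = 2`): `265·5·66 = 87450 ≤ 10^{12}∕2` (closed arithmetic) -/
example : (((2 * cth 32 1 4 + 1) ^ 1 : ℕ) : ℝ) * (5 : ℝ) ^ 1 * ((66 : ℕ) : ℝ) ≤ ((10 ^ 6 : ℕ) : ℝ) ^ (4 / 2) / 2 := by
  norm_num [cth]

end Sanity

end

end Summit.QuantumFields.BalabanUV.T4Continuum.HistoryZoneMassRegions
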